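import Literature.NumberTheory.Sieve.RoughNumbersCoprimeProgressions
import Literature.NumberTheory.Sieve.SieveFrameworkFundamentalLemma
import Mathlib.NumberTheory.ArithmeticFunction.Liouville
import Mathlib.NumberTheory.DirichletCharacter.Basic
import Mathlib.Analysis.SpecialFunctions.Log.Basic
import Mathlib.NumberTheory.Harmonic.Bounds
import HarnessLib

/-!
# Sifted Liouville sums in residue classes: the fundamental-lemma step of Lichtman's Lemma 4.8

Topic `Literature/NumberTheory/Sieve`.  Everything in this file is PROVED (from the tree's
Fundamental Lemma `SieveSequence.fundamental_lemma_uniform_holds`, Friedlander–Iwaniec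
*Opera de Cribro* Cor. 6.10).  It is the sieve half of a proof of Lemma 4.8 of J. D. Lichtman,
*Averages of the Möbius function on shifted primes*, arXiv:2009.08969 [Lichtman2020] (p. 12:
`∑_{m ≤ x, (m,𝒟)=1} λ(m)χ(m) ≪_{A,K} x/(log x)^K`, `𝒟 = ∏_{p ∈ 𝒫} p`, `𝒫 ⊂ (q, x^{1/log log x})`; the
tree's named fact `Lichtman2020_liouvilleCharacterSifted`), following the printed proof
(pp. 12–13): partition by the residue `b (mod q)` and the sign `ν = λ(m)` ((4.1)), count the sifted
elements of the class `𝒜^{(b,ν)} = {m ≤ x : m ≡ b (q), λ(m) = ν}` with the fundamental lemma ((4.2),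
(4.4)), the remainders being controlled by the Liouville sums in progressions ((4.3),
"Siegel–Walfisz"), and note that the main terms cancel in `ν` (p. 12, "by pairing up terms
`ν = ±1`").

* `LiouvilleSifted.primePart Ps n = ∏_{p ∈ Ps, p ∣ n} p` — the radical of the `𝒫`-part of `n`; the
  class `𝒜^{(b,ν)}` is sifted by the primes of an ARBITRARY finite set `Ps` of primes below `z` by
  sifting the values `primePart Ps n` by all primes below `z` (`classSeq`, density `psRecip Ps`:
  `g(p) = 1/p` on `Ps`, `0` off `Ps`, dimension `1` with the absolute constant `e⁵`).
* `LiouvilleSifted.abs_remainder_le` — `|R_d| ≤ 1 + ½ B_d` for any bound `B_d` of the progression sums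
  `|∑_{m ≤ N/d, m ≡ c (q)} λ(m)|` uniform over the residues `c` ((4.3); only `c = bd⁻¹` is used).
* `LiouvilleSifted.sifted_sum_eq` — (4.1): `∑_{n ≤ N, (n,𝒟)=1} λ(n)χ(n) = ∑_b χ(b) (S^{(b,+)} - S^{(b,-)})`.
* `LiouvilleSifted.norm_sifted_sum_le` — THE RESULT of this file: for `1 ≤ q`, `Ps` a finite set of
  primes in `(q, z)`, `2 ≤ z ≤ D`, and a uniform bound
  `|∑_{m ≤ M, m ≡ c (q)} λ(m)| ≤ ε M` for `M ≥ M₀` (`N ≥ D (M₀ + 1)`),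
  `‖∑_{n ≤ N, (n,𝒟)=1} λ(n)χ(n)‖ ≤ C_FL N e^{-log D/log z} + 2qD + qεN(1 + log D)`,
  `C_FL` the constant of the fundamental lemma in dimension `1` with `K = e⁵`.

The choice of `z`, `D`, `ε` and the treatment of the primes of `𝒫` above `z` (where Lichtman's
printed choice `D = z^s`, `s = 2K log₂x/log₃x` relies on the `β`-sieve error `s^{-s}`, while the
tree's fundamental lemma has `e^{-s}`) are in `LiouvilleSiftedCharSum.lean`.

## References

* J. D. Lichtman, arXiv:2009.08969, Lemma 4.8 and its proof, (4.1)–(4.4), pp. 12–13. [Lichtman2020]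
* J. Friedlander, H. Iwaniec, *Opera de Cribro*, AMS Colloquium Publ. 57 (2010), Cor. 6.10.
  [FriedlanderIwaniecOpera2010]
-/

open Finset ArithmeticFunction

noncomputable section

namespace Literature.NumberTheory.Sieve

namespace LiouvilleSifted

/-! ### The `𝒫`-part of an integer -/

/-- `primePart Ps n = ∏_{p ∈ Ps, p ∣ n} p`: the product of the primes of `Ps` dividing `n` (the
radical of the `𝒫`-part of `n`; `= 1` iff no `p ∈ Ps` divides `n`). [folklore] -/
def primePart (Ps : Finset ℕ) (n : ℕ) : ℕ := ∏ p ∈ Ps.filter (· ∣ n), p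

variable {Ps : Finset ℕ}

/-- `primePart Ps n ≥ 1` when `Ps` consists of primes. [folklore] -/
theorem primePart_pos (hPs : ∀ p ∈ Ps, p.Prime) (n : ℕ) : 0 < primePart Ps n :=
  Finset.prod_pos fun p hp => (hPs p (Finset.mem_filter.1 hp).1).pos

/-- A prime divides `primePart Ps n` iff it lies in `Ps` and divides `n`. [folklore] -/
theorem prime_dvd_primePart_iff (hPs : ∀ p ∈ Ps, p.Prime) {p n : ℕ} (hp : p.Prime) :
    p ∣ primePart Ps n ↔ p ∈ Ps ∧ p ∣ n := by
  unfold primePart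
  constructor
  · intro h
    rw [(Nat.prime_iff.1 hp).dvd_finsetProd_iff] at h
    obtain ⟨r, hr, hpr⟩ := h
    rw [Finset.mem_filter] at hr
    have : p = r := (Nat.prime_dvd_prime_iff_eq hp (hPs r hr.1)).1 hpr
    subst this
    exact hr
  · rintro ⟨hpP, hpn⟩
    exact Finset.dvd_prod_of_mem _ (Finset.mem_filter.2 ⟨hpP, hpn⟩)

/-- `primePart Ps n ∣ n`. [folklore] -/
theorem primePart_dvd (hPs : ∀ p ∈ Ps, p.Prime) {n : ℕ} : primePart Ps n ∣ n :=
  Finset.prod_primes_dvd n (fun p hp => Nat.prime_iff.1 (hPs p (Finset.mem_filter.1 hp).1))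
    fun _ hp => (Finset.mem_filter.1 hp).2

/-- `primePart Ps n ≤ n` for `n ≠ 0`. [folklore] -/
theorem primePart_le (hPs : ∀ p ∈ Ps, p.Prime) {n : ℕ} (hn : n ≠ 0) : primePart Ps n ≤ n :=
  Nat.le_of_dvd (Nat.pos_of_ne_zero hn) (primePart_dvd hPs)

/-- For squarefree `d`: `d ∣ primePart Ps n` iff every prime factor of `d` lies in `Ps` and `d ∣ n`. [folklore] -/
theorem dvd_primePart_iff_of_squarefree (hPs : ∀ p ∈ Ps, p.Prime) {d n : ℕ} (hd : Squarefree d) :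
    d ∣ primePart Ps n ↔ (∀ p ∈ d.primeFactors, p ∈ Ps) ∧ d ∣ n := by
  constructor
  · intro h
    refine ⟨fun p hp => ?_, h.trans (primePart_dvd hPs)⟩
    have hpp := Nat.prime_of_mem_primeFactors hp
    exact ((prime_dvd_primePart_iff hPs hpp).1 ((Nat.dvd_of_mem_primeFactors hp).trans h)).1
  · rintro ⟨hall, hdn⟩
    rw [← Nat.prod_primeFactors_of_squarefree hd]
    refine Finset.prod_primes_dvd _ (fun p hp => Nat.prime_iff.1 (Nat.prime_of_mem_primeFactors hp))
      fun p hp => ?_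
    exact (prime_dvd_primePart_iff hPs (Nat.prime_of_mem_primeFactors hp)).2
      ⟨hall p hp, (Nat.dvd_of_mem_primeFactors hp).trans hdn⟩

/-- `primePart Ps n` is coprime to `P(z)` iff no `p ∈ Ps` divides `n`, when `Ps` consists of primes
below `z`. [folklore] -/
theorem coprime_primePart_primesProdBelow_iff (hPs : ∀ p ∈ Ps, p.Prime) {z : ℝ}
    (hPz : ∀ p ∈ Ps, (p : ℝ) < z) (n : ℕ) :
    (primePart Ps n).Coprime (primesProdBelow z) ↔ ∀ p ∈ Ps, ¬ p ∣ n := by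
  rw [coprime_primesProdBelow_iff]
  constructor
  · intro h p hp hpn
    have hpz : p ∈ Nat.primesBelow ⌈z⌉₊ :=
      Nat.mem_primesBelow.2 ⟨Nat.lt_ceil.2 (hPz p hp), hPs p hp⟩
    exact h p hpz ((prime_dvd_primePart_iff hPs (hPs p hp)).2 ⟨hp, hpn⟩)
  · intro h r hr hrd
    have hrp := Nat.prime_of_mem_primesBelow hr
    obtain ⟨hrP, hrn⟩ := (prime_dvd_primePart_iff hPs hrp).1 hrd
    exact h r hrP hrn

/-! ### The density `g(d) = 1/d` on `Ps`-smooth `d`, `0` otherwise -/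

/-- The density of the sifting problem: `g(d) = 1/d` if every prime factor of `d` lies in `Ps`
(`d ≠ 0`), and `0` otherwise. [folklore] -/
def psRecip (Ps : Finset ℕ) : ArithmeticFunction ℝ where
  toFun d := if d ≠ 0 ∧ ∀ p ∈ d.primeFactors, p ∈ Ps then ((d : ℝ))⁻¹ else 0
  map_zero' := by simp

/-- Unfolding `psRecip`. [folklore] -/
theorem psRecip_apply (Ps : Finset ℕ) (d : ℕ) :
    psRecip Ps d = if d ≠ 0 ∧ ∀ p ∈ d.primeFactors, p ∈ Ps then ((d : ℝ))⁻¹ else 0 := rfl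

/-- `psRecip` is multiplicative. [folklore] -/
theorem isMultiplicative_psRecip (Ps : Finset ℕ) : (psRecip Ps).IsMultiplicative := by
  refine ⟨by simp [psRecip_apply], fun {m n} hmn => ?_⟩
  rcases eq_or_ne m 0 with rfl | hm
  · simp [psRecip_apply]
  rcases eq_or_ne n 0 with rfl | hn
  · simp [psRecip_apply]
  have hmn0 : m * n ≠ 0 := mul_ne_zero hm hn
  have key : (∀ p ∈ (m * n).primeFactors, p ∈ Ps) ↔
      (∀ p ∈ m.primeFactors, p ∈ Ps) ∧ (∀ p ∈ n.primeFactors, p ∈ Ps) := by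
    rw [Nat.primeFactors_mul hm hn]
    simp only [Finset.mem_union, or_imp, forall_and]
  simp only [psRecip_apply, ne_eq, hmn0, hm, hn, not_false_eq_true, true_and, key]
  by_cases h1 : ∀ p ∈ m.primeFactors, p ∈ Ps <;> by_cases h2 : ∀ p ∈ n.primeFactors, p ∈ Ps
  · rw [if_pos ⟨h1, h2⟩, if_pos h1, if_pos h2]; push_cast; rw [mul_inv]
  · rw [if_neg (fun h => h2 h.2), if_neg h2, mul_zero]
  · rw [if_neg (fun h => h1 h.1), if_neg h1, zero_mul]
  · rw [if_neg (fun h => h1 h.1), if_neg h1, zero_mul]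

/-- `0 ≤ g(d)`. [folklore] -/
theorem psRecip_nonneg (Ps : Finset ℕ) (d : ℕ) : 0 ≤ psRecip Ps d := by
  rw [psRecip_apply]; split_ifs <;> positivity

/-- `g(d) ≤ 1/d`. [folklore] -/
theorem psRecip_le_inv (Ps : Finset ℕ) (d : ℕ) : psRecip Ps d ≤ ((d : ℝ))⁻¹ := by
  rw [psRecip_apply]; split_ifs <;> [exact le_rfl; positivity]

/-- `g(p) < 1` at primes. [folklore] -/
theorem psRecip_lt_one (Ps : Finset ℕ) {p : ℕ} (hp : p.Prime) : psRecip Ps p < 1 :=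
  (psRecip_le_inv Ps p).trans_lt (inv_lt_one_of_one_lt₀ (by exact_mod_cast hp.one_lt))

/-- `g` has sieve dimension `1` with the absolute constant `e⁵` (as for the tree's
`BFI.coprimeRecip`: `∏_{w ≤ p < z} (1 − g(p))⁻¹ ≤ ∏_{w ≤ p ≤ z} (1 − 1/p)⁻¹ ≤ e⁵ log z / log w`). [folklore] -/
theorem hasSieveDimension_psRecip (Ps : Finset ℕ) : HasSieveDimension (psRecip Ps) 1 (Real.exp 5) := by
  refine ⟨fun p hp => ⟨psRecip_nonneg Ps p, psRecip_lt_one Ps hp⟩, fun w z hw hwz => ?_⟩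
  rw [Real.rpow_one, ← mul_div_assoc]
  refine le_trans ?_ (BombieriSieve.prod_primesGe_one_sub_inv_inv_le hw hwz)
  calc ∏ p ∈ (Nat.primesBelow ⌈z⌉₊).filter (fun p : ℕ => w ≤ (p : ℝ)), (1 - psRecip Ps p)⁻¹
      ≤ ∏ p ∈ (Nat.primesBelow ⌈z⌉₊).filter (fun p : ℕ => w ≤ (p : ℝ)), (1 - (p : ℝ)⁻¹)⁻¹ := by
        refine Finset.prod_le_prod (fun p hp => ?_) fun p hp => ?_
        · have hpp := Nat.prime_of_mem_primesBelow (Finset.mem_filter.1 hp).1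
          exact inv_nonneg.2 (sub_nonneg.2 (psRecip_lt_one Ps hpp).le)
        · have hpp := Nat.prime_of_mem_primesBelow (Finset.mem_filter.1 hp).1
          have hp1 : (1 : ℝ) < p := by exact_mod_cast hpp.one_lt
          refine inv_anti₀ (sub_pos.2 (inv_lt_one_of_one_lt₀ hp1)) ?_
          linarith [psRecip_le_inv Ps p]
    _ ≤ ∏ p ∈ (Nat.primesLE ⌊z⌋₊).filter (fun p : ℕ => w ≤ (p : ℝ)), (1 - (p : ℝ)⁻¹)⁻¹ := by
        refine Finset.prod_le_prod_of_subset_of_one_le (fun p hp => ?_) (fun p hp => ?_)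
          (fun p hp _ => ?_)
        · obtain ⟨hp, hwp⟩ := Finset.mem_filter.mp hp
          obtain ⟨hpz, hpp⟩ := Nat.mem_primesBelow.mp hp
          exact BombieriSieve.mem_primesGe.mpr ⟨hpp, hwp, Nat.le_floor (Nat.lt_ceil.mp hpz).le⟩
        · exact inv_nonneg.mpr (sub_nonneg.mpr (Nat.cast_inv_le_one p))
        · have hp1 : (1 : ℝ) < p := by exact_mod_cast (BombieriSieve.mem_primesGe.mp hp).1.one_lt
          exact (one_le_inv₀ (sub_pos.mpr (inv_lt_one_of_one_lt₀ hp1))).mpr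
            (sub_le_self _ (inv_nonneg.mpr (Nat.cast_nonneg p)))

/-! ### The sign classes `𝒜^{(b,ν)}` and their sieve sequences -/

/-- `𝒜^{(b,ν)} = {0 < n ≤ N : n ≡ b (mod q), λ(n) = ν}` (p. 12, (4.1)). [cite: Lichtman2020, Lemma 4.8, proof (4.1)] -/
def signClass (N q : ℕ) (b : ZMod q) (ν : ℤ) : Finset ℕ :=
  (Ioc 0 N).filter (fun n : ℕ => (n : ZMod q) = b ∧ liouville n = ν)

/-- The sieve sequence of the class `𝒜^{(b,ν)}`, sifted along the values `primePart Ps n`: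
`a_k = #{n ∈ 𝒜^{(b,ν)} : primePart Ps n = k}`, `X = N/(2q)`, density `psRecip Ps`. [folklore] -/
def classSeq (N q : ℕ) (b : ZMod q) (ν : ℤ) (Ps : Finset ℕ) : SieveSequence where
  a k := #((signClass N q b ν).filter (fun n : ℕ => primePart Ps n = k))
  a_nonneg _ := Nat.cast_nonneg _
  size _ := (N : ℝ) / (2 * q)
  density := psRecip Ps
  density_mult := isMultiplicative_psRecip Ps

/-- Fibrewise counting: `∑_{k ∈ t} #{n ∈ s : Φ(n) = k} = #{n ∈ s : Φ(n) ∈ t}`. [folklore] -/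
theorem sum_card_filter_eq (s : Finset ℕ) (t : Finset ℕ) (Φ : ℕ → ℕ) :
    ∑ k ∈ t, (#(s.filter (fun n => Φ n = k)) : ℝ) = #(s.filter (fun n => Φ n ∈ t)) := by
  rw [Finset.card_eq_sum_card_fiberwise (f := Φ) (s := s.filter (fun n => Φ n ∈ t)) (t := t)
    (fun n hn => by
      have := (Finset.mem_filter.1 (Finset.mem_coe.1 hn)).2
      exact Finset.mem_coe.2 this)]
  push_cast
  refine Finset.sum_congr rfl fun k hk => ?_
  congr 1
  congr 1
  ext n
  simp only [Finset.mem_filter]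
  constructor
  · rintro ⟨hn, rfl⟩; exact ⟨⟨hn, hk⟩, rfl⟩
  · rintro ⟨⟨hn, -⟩, h⟩; exact ⟨hn, h⟩

/-- The sifted sum of `classSeq` at height `N`, sifting by the primes below `z ⊇ Ps`:
`S = #{n ∈ 𝒜^{(b,ν)} : no p ∈ Ps divides n}`. [folklore] -/
theorem classSeq_sifted (hPs : ∀ p ∈ Ps, p.Prime) {z : ℝ} (hPz : ∀ p ∈ Ps, (p : ℝ) < z)
    (N q : ℕ) (b : ZMod q) (ν : ℤ) :
    (classSeq N q b ν Ps).sifted N (primesProdBelow z) =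
      #((signClass N q b ν).filter (fun n : ℕ => ∀ p ∈ Ps, ¬ p ∣ n)) := by
  rw [SieveSequence.sifted, Nat.floor_natCast]
  change ∑ k ∈ (Ioc 0 N).filter (fun k : ℕ => k.Coprime (primesProdBelow z)),
    (#((signClass N q b ν).filter (fun n : ℕ => primePart Ps n = k)) : ℝ) = _
  rw [sum_card_filter_eq]
  congr 2
  ext n
  simp only [Finset.mem_filter, Finset.mem_Ioc, signClass]
  constructor
  · rintro ⟨hn, -, hcop⟩
    exact ⟨hn, (coprime_primePart_primesProdBelow_iff hPs hPz n).1 hcop⟩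
  · rintro ⟨hn, hall⟩
    refine ⟨hn, ⟨primePart_pos hPs n, ?_⟩, (coprime_primePart_primesProdBelow_iff hPs hPz n).2 hall⟩
    exact (primePart_le hPs (by have := hn.1.1; omega)).trans hn.1.2

/-- `A_d(N) = #{n ∈ 𝒜^{(b,ν)} : d ∣ primePart Ps n}` for `classSeq`. [folklore] -/
theorem classSeq_congrSum (hPs : ∀ p ∈ Ps, p.Prime) (N q : ℕ) (b : ZMod q) (ν : ℤ) (d : ℕ) :
    (classSeq N q b ν Ps).congrSum d N =
      #((signClass N q b ν).filter (fun n : ℕ => d ∣ primePart Ps n)) := by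
  rw [SieveSequence.congrSum, Nat.floor_natCast]
  change ∑ k ∈ (Ioc 0 N).filter (d ∣ ·),
    (#((signClass N q b ν).filter (fun n : ℕ => primePart Ps n = k)) : ℝ) = _
  rw [sum_card_filter_eq]
  congr 2
  ext n
  simp only [Finset.mem_filter, Finset.mem_Ioc, signClass]
  constructor
  · rintro ⟨hn, -, hd⟩; exact ⟨hn, hd⟩
  · rintro ⟨hn, hd⟩
    refine ⟨hn, ⟨primePart_pos hPs n, ?_⟩, hd⟩
    exact (primePart_le hPs (by have := hn.1.1; omega)).trans hn.1.2


/-! ### The remainders ((4.3)) -/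

/-- `λ(n) ∈ {1, -1}` for `n ≠ 0`. [folklore] -/
theorem liouville_eq_one_or (n : ℕ) (hn : n ≠ 0) : liouville n = 1 ∨ liouville n = -1 := by
  rw [liouville_apply hn]
  rcases Nat.even_or_odd (cardFactors n) with h | h
  · left; exact h.neg_one_pow
  · right; exact h.neg_one_pow

/-- Counting a sign class in a progression: for `ν' ∈ {±1}`,
`#{0 < m ≤ M : m ≡ c, λ(m) = ν'} = ½ #{0 < m ≤ M : m ≡ c} + ½ ν' ∑_{0 < m ≤ M, m ≡ c} λ(m)`. [folklore] -/
theorem card_signClass_eq {q : ℕ} (c : ZMod q) {ν' : ℤ} (hν' : ν' = 1 ∨ ν' = -1) (M : ℕ) :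
    (#(signClass M q c ν') : ℝ) =
      (1 / 2) * #((Ioc 0 M).filter (fun m : ℕ => (m : ZMod q) = c)) +
        (1 / 2) * ν' * ∑ m ∈ (Ioc 0 M).filter (fun m : ℕ => (m : ZMod q) = c), (liouville m : ℝ) := by
  unfold signClass
  rw [← Finset.filter_filter, Finset.card_eq_sum_ones, Nat.cast_sum, Finset.sum_filter,
    Finset.card_eq_sum_ones, Nat.cast_sum, Finset.mul_sum, Finset.mul_sum, ← Finset.sum_add_distrib]
  refine Finset.sum_congr rfl fun m hm => ?_
  have hm0 : m ≠ 0 := by have := (Finset.mem_Ioc.1 (Finset.mem_filter.1 hm).1).1; omega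
  push_cast
  rcases liouville_eq_one_or m hm0 with h | h <;> rcases hν' with rfl | rfl <;> simp [h] <;> norm_num

/-- `|#{0 < m ≤ M : m ≡ c (mod q)} − M/q| ≤ 1`. [folklore] -/
theorem abs_card_filter_zmod_sub_le {q : ℕ} (hq : 0 < q) (c : ZMod q) (M : ℕ) :
    |(#((Ioc 0 M).filter (fun m : ℕ => (m : ZMod q) = c)) : ℝ) - (M : ℝ) / q| ≤ 1 := by
  haveI : NeZero q := ⟨hq.ne'⟩
  have hset : (Ioc 0 M).filter (fun m : ℕ => (m : ZMod q) = c) =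
      (Ioc 0 M).filter (fun m : ℕ => m ≡ c.val [MOD q]) := by
    refine Finset.filter_congr fun m _ => ?_
    rw [← ZMod.natCast_eq_natCast_iff, ZMod.natCast_zmod_val]
  rw [hset]
  have := BFI.abs_card_Ioc_filter_modEq_sub_le hq c.val (Nat.zero_le M)
  simpa using this

/-- The elements of `𝒜^{(b,ν)}` divisible by `d`, `(d, q) = 1`, `d ≠ 0`: dividing by `d` gives the sign
class `ν λ(d)` in the progression `b d⁻¹`. [folklore] -/
theorem card_signClass_filter_dvd_eq {N q d : ℕ} (hd : 0 < d) (hdq : d.Coprime q) (b : ZMod q)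
    (ν : ℤ) :
    #((signClass N q b ν).filter (fun n : ℕ => d ∣ n)) =
      #(signClass (N / d) q (b * ((d : ZMod q))⁻¹) (ν * liouville d)) := by
  show _ = #((Ioc 0 (N / d)).filter (fun m : ℕ => (m : ZMod q) = b * ((d : ZMod q))⁻¹ ∧
        liouville m = ν * liouville d))
  have hu : IsUnit ((d : ZMod q)) := (ZMod.isUnit_iff_coprime d q).2 hdq
  have hld : liouville d = 1 ∨ liouville d = -1 := liouville_eq_one_or d hd.ne'
  have h1 : (signClass N q b ν).filter (fun n : ℕ => d ∣ n) =
      (Ioc 0 N).filter (fun n : ℕ => d ∣ n ∧ ((n : ZMod q) = b ∧ liouville n = ν)) := by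
    unfold signClass
    rw [Finset.filter_filter]
    refine Finset.filter_congr fun n _ => ?_
    tauto
  rw [h1, BFI.card_filter_dvd_eq hd 0 N, Nat.zero_div]
  congr 1
  refine Finset.filter_congr fun m _ => ?_
  rw [Nat.cast_mul, liouville_apply_mul]
  constructor
  · rintro ⟨hb, hl⟩
    constructor
    · rw [← hb, mul_comm ((d : ZMod q)) (m : ZMod q), mul_assoc, ZMod.mul_inv_of_unit _ hu, mul_one]
    · rw [← hl]
      rcases hld with h | h <;> simp [h]
  · rintro ⟨hc, hl⟩
    constructor
    · rw [hc, mul_comm, mul_assoc, ZMod.inv_mul_of_unit _ hu, mul_one]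
    · rw [hl]
      rcases hld with h | h <;> simp [h]

/-- **(4.3): the remainders of `classSeq`.**  Let `Ps` consist of primes `> q`, `ν ∈ {±1}`, and
`d ∣ P(z)`.  If `Bd` bounds all progression sums `|∑_{0 < m ≤ N/d, m ≡ c (q)} λ(m)|`, then
`|R_d(N)| ≤ 1 + Bd/2`: for `Ps`-smooth `d` one has `A_d = #{n ∈ 𝒜^{(b,ν)} : d ∣ n}`, which after
division by `d` is a sign class in a progression, counted by `card_signClass_eq`; otherwise
`A_d = g(d) = 0`. [cite: Lichtman2020, Lemma 4.8, proof (4.3)] -/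
theorem abs_remainder_le (hPs : ∀ p ∈ Ps, p.Prime) {q : ℕ} (hq : 0 < q) (hPq : ∀ p ∈ Ps, q < p)
    {N : ℕ} (b : ZMod q) {ν : ℤ} (hν : ν = 1 ∨ ν = -1) {z : ℝ} {d : ℕ} (hd : d ∣ primesProdBelow z)
    {Bd : ℝ}
    (hΛ : ∀ c : ZMod q, |∑ m ∈ (Ioc 0 (N / d)).filter (fun m : ℕ => (m : ZMod q) = c),
      (liouville m : ℝ)| ≤ Bd) :
    |(classSeq N q b ν Ps).remainder d N| ≤ 1 + Bd / 2 := by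
  have hΛ0 : 0 ≤ Bd := (abs_nonneg _).trans (hΛ 0)
  have hdsq : Squarefree d := (squarefree_primesProdBelow z).squarefree_of_dvd hd
  have hd0 : d ≠ 0 := hdsq.ne_zero
  have hdpos : 0 < d := Nat.pos_of_ne_zero hd0
  rw [SieveSequence.remainder, classSeq_congrSum hPs]
  change |(#((signClass N q b ν).filter (fun n : ℕ => d ∣ primePart Ps n)) : ℝ) -
    psRecip Ps d * ((N : ℝ) / (2 * q))| ≤ 1 + Bd / 2
  rw [psRecip_apply]
  by_cases hA : ∀ p ∈ d.primeFactors, p ∈ Ps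
  · rw [if_pos ⟨hd0, hA⟩]
    -- `(d, q) = 1`
    have hdq : d.Coprime q := by
      refine Nat.coprime_of_dvd fun p hp hpd hpq => ?_
      have hpP : p ∈ Ps := hA p (Nat.mem_primeFactors.2 ⟨hp, hpd, hd0⟩)
      exact absurd (Nat.le_of_dvd hq hpq) (not_le.2 (hPq p hpP))
    have hset : (signClass N q b ν).filter (fun n : ℕ => d ∣ primePart Ps n) =
        (signClass N q b ν).filter (fun n : ℕ => d ∣ n) := by
      refine Finset.filter_congr fun n _ => ?_
      rw [dvd_primePart_iff_of_squarefree hPs hdsq]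
      exact ⟨fun h => h.2, fun h => ⟨hA, h⟩⟩
    rw [hset, card_signClass_filter_dvd_eq hdpos hdq b ν]
    set c : ZMod q := b * ((d : ZMod q))⁻¹
    have hν' : ν * liouville d = 1 ∨ ν * liouville d = -1 := by
      rcases hν with rfl | rfl <;> rcases liouville_eq_one_or d hd0 with h | h <;> simp [h]
    rw [card_signClass_eq c hν' (N / d)]
    set M := N / d with hM
    have h1 := abs_card_filter_zmod_sub_le hq c M
    have h2 := hΛ c
    have hq' : (0 : ℝ) < q := by exact_mod_cast hq
    have hd' : (0 : ℝ) < d := by exact_mod_cast hdpos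
    -- `|M − N/d| ≤ 1`
    have hM1 : ((M : ℕ) : ℝ) ≤ (N : ℝ) / d := by rw [hM]; exact Nat.cast_div_le
    have hM2 : (N : ℝ) / d - 1 ≤ (M : ℕ) := by
      rw [hM, div_sub_one hd'.ne', div_le_iff₀ hd']
      have := Nat.lt_div_mul_add (a := N) hdpos
      have : ((N : ℕ) : ℝ) < ((N / d * d + d : ℕ) : ℝ) := by exact_mod_cast this
      push_cast at this
      linarith
    have hνabs : |((ν * liouville d : ℤ) : ℝ)| = 1 := by
      rcases hν' with h | h <;> simp [h]
    -- assemble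
    have e : (1 / 2 : ℝ) * #((Ioc 0 M).filter (fun m : ℕ => (m : ZMod q) = c)) +
        (1 / 2) * ((ν * liouville d : ℤ) : ℝ) * ∑ m ∈ (Ioc 0 M).filter (fun m : ℕ => (m : ZMod q) = c),
          (liouville m : ℝ) - ((d : ℝ))⁻¹ * ((N : ℝ) / (2 * q))
        = (1 / 2) * ((#((Ioc 0 M).filter (fun m : ℕ => (m : ZMod q) = c)) : ℝ) - (M : ℝ) / q)
          + (1 / 2) * (((M : ℝ) - (N : ℝ) / d) / q)
          + (1 / 2) * ((ν * liouville d : ℤ) : ℝ) *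
            ∑ m ∈ (Ioc 0 M).filter (fun m : ℕ => (m : ZMod q) = c), (liouville m : ℝ) := by
      field_simp
      ring
    rw [e]
    have hB : |(1 / 2 : ℝ) * (((M : ℝ) - (N : ℝ) / d) / q)| ≤ 1 / 2 := by
      rw [abs_mul, abs_of_pos (by norm_num : (0:ℝ) < 1 / 2), abs_div, abs_of_pos hq']
      have hq1 : (1 : ℝ) ≤ q := by exact_mod_cast hq
      have : |(M : ℝ) - (N : ℝ) / d| ≤ 1 := by rw [abs_le]; constructor <;> linarith
      calc (1 / 2 : ℝ) * (|(M : ℝ) - (N : ℝ) / d| / q) ≤ (1 / 2) * (1 / 1) := by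
            gcongr
        _ = 1 / 2 := by norm_num
    calc _ ≤ |(1 / 2 : ℝ) * ((#((Ioc 0 M).filter (fun m : ℕ => (m : ZMod q) = c)) : ℝ) - (M : ℝ) / q)|
          + |(1 / 2 : ℝ) * (((M : ℝ) - (N : ℝ) / d) / q)|
          + |(1 / 2 : ℝ) * ((ν * liouville d : ℤ) : ℝ) *
              ∑ m ∈ (Ioc 0 M).filter (fun m : ℕ => (m : ZMod q) = c), (liouville m : ℝ)| :=
          abs_add_three _ _ _
      _ ≤ (1 / 2) * 1 + 1 / 2 + (1 / 2) * Bd := by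
          refine add_le_add (add_le_add ?_ hB) ?_
          · rw [abs_mul, abs_of_pos (by norm_num : (0:ℝ) < 1 / 2)]
            exact mul_le_mul_of_nonneg_left h1 (by norm_num)
          · rw [abs_mul, abs_mul, hνabs, abs_of_pos (by norm_num : (0:ℝ) < 1 / 2), mul_one]
            exact mul_le_mul_of_nonneg_left h2 (by norm_num)
      _ = 1 + Bd / 2 := by ring
  · rw [if_neg (fun h => hA h.2), zero_mul, sub_zero]
    have hempty : (signClass N q b ν).filter (fun n : ℕ => d ∣ primePart Ps n) = ∅ := by
      rw [Finset.filter_eq_empty_iff]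
      intro n _ hdn
      exact hA ((dvd_primePart_iff_of_squarefree hPs hdsq).1 hdn).1
    rw [hempty, Finset.card_empty, Nat.cast_zero, abs_zero]
    linarith

/-! ### (4.1): residues and signs -/

/-- `∑_{n ∈ R_b} λ(n) = #{λ = 1} − #{λ = −1}` on a set of positive integers. [folklore] -/
theorem sum_liouville_eq_card_sub_card (R : Finset ℕ) (hR : ∀ n ∈ R, n ≠ 0) :
    ∑ n ∈ R, ((liouville n : ℤ) : ℂ) =
      (#(R.filter (fun n : ℕ => liouville n = 1)) : ℂ) - #(R.filter (fun n : ℕ => liouville n = -1)) := by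
  rw [Finset.card_eq_sum_ones, Finset.card_eq_sum_ones, Nat.cast_sum, Nat.cast_sum,
    Finset.sum_filter, Finset.sum_filter, ← Finset.sum_sub_distrib]
  refine Finset.sum_congr rfl fun n hn => ?_
  rcases liouville_eq_one_or n (hR n hn) with h | h <;> simp [h]

/-- **(4.1)**: `∑_{0 < n ≤ N, (n,𝒟)=1} λ(n)χ(n) = ∑_{b (mod q)} χ(b) (S^{(b,+)} − S^{(b,−)})`, where
`S^{(b,ν)} = #{n ∈ 𝒜^{(b,ν)} : (n, 𝒟) = 1}`. [cite: Lichtman2020, Lemma 4.8, proof (4.1)] -/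
theorem sifted_sum_eq {q : ℕ} [NeZero q] (χ : DirichletCharacter ℂ q) (N : ℕ) (Ps : Finset ℕ) :
    ∑ n ∈ (Icc 1 N).filter (fun n : ℕ => ∀ p ∈ Ps, ¬ p ∣ n),
        ((liouville n : ℤ) : ℂ) * χ (n : ZMod q) =
      ∑ b : ZMod q, χ b *
        ((#((signClass N q b 1).filter (fun n : ℕ => ∀ p ∈ Ps, ¬ p ∣ n)) : ℂ) -
          #((signClass N q b (-1)).filter (fun n : ℕ => ∀ p ∈ Ps, ¬ p ∣ n))) := by
  have hIcc : Icc 1 N = Ioc 0 N := rfl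
  rw [hIcc]
  set R := (Ioc 0 N).filter (fun n : ℕ => ∀ p ∈ Ps, ¬ p ∣ n) with hRdef
  rw [← Finset.sum_fiberwise R (fun n : ℕ => (n : ZMod q))]
  refine Finset.sum_congr rfl fun b _ => ?_
  have h1 : ∑ n ∈ R.filter (fun n : ℕ => (n : ZMod q) = b), ((liouville n : ℤ) : ℂ) * χ (n : ZMod q)
      = χ b * ∑ n ∈ R.filter (fun n : ℕ => (n : ZMod q) = b), ((liouville n : ℤ) : ℂ) := by
    rw [Finset.mul_sum]
    refine Finset.sum_congr rfl fun n hn => ?_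
    rw [(Finset.mem_filter.1 hn).2, mul_comm]
  rw [h1]
  congr 1
  have hR0 : ∀ n ∈ R.filter (fun n : ℕ => (n : ZMod q) = b), n ≠ 0 := by
    intro n hn
    have := (Finset.mem_Ioc.1 (Finset.mem_filter.1 (Finset.mem_filter.1 hn).1).1).1
    omega
  rw [sum_liouville_eq_card_sub_card _ hR0]
  have hset : ∀ ν : ℤ, (R.filter (fun n : ℕ => (n : ZMod q) = b)).filter (fun n : ℕ => liouville n = ν)
      = (signClass N q b ν).filter (fun n : ℕ => ∀ p ∈ Ps, ¬ p ∣ n) := by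
    intro ν
    ext n
    simp only [hRdef, signClass, Finset.mem_filter]
    tauto
  rw [hset 1, hset (-1)]

/-! ### The fundamental lemma for the sign classes, and the main bound -/

/-- `0 ≤ V ≤ 1` for the density product of `classSeq`. [folklore] -/
theorem densityProduct_mem (N q : ℕ) (b : ZMod q) (ν : ℤ) (Ps : Finset ℕ) (P : ℕ) :
    0 ≤ (classSeq N q b ν Ps).densityProduct P ∧ (classSeq N q b ν Ps).densityProduct P ≤ 1 := by
  unfold SieveSequence.densityProduct
  change 0 ≤ ∏ p ∈ P.primeFactors, (1 - psRecip Ps p) ∧ ∏ p ∈ P.primeFactors, (1 - psRecip Ps p) ≤ 1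
  have h1 : ∀ p ∈ P.primeFactors, 0 ≤ 1 - psRecip Ps p := fun p hp =>
    sub_nonneg.2 (psRecip_lt_one Ps (Nat.prime_of_mem_primeFactors hp)).le
  exact ⟨Finset.prod_nonneg h1, Finset.prod_le_one h1 fun p _ => sub_le_self _ (psRecip_nonneg Ps p)⟩

/-- `∑_{d ∣ P, d ≤ D} 1/d ≤ 1 + log D` for `D ≥ 1`. [folklore] -/
theorem sum_divisors_filter_inv_le (P : ℕ) {D : ℝ} (hD : 1 ≤ D) :
    ∑ d ∈ P.divisors.filter (fun d : ℕ => (d : ℝ) ≤ D), (1 : ℝ) / d ≤ 1 + Real.log D := by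
  have hD0 : 0 < D := by linarith
  have hsub : P.divisors.filter (fun d : ℕ => (d : ℝ) ≤ D) ⊆ Finset.Icc 1 ⌊D⌋₊ := by
    intro d hd
    rw [Finset.mem_filter, Nat.mem_divisors] at hd
    rw [Finset.mem_Icc]
    exact ⟨Nat.pos_of_dvd_of_pos hd.1.1 (Nat.pos_of_ne_zero hd.1.2), Nat.le_floor hd.2⟩
  calc ∑ d ∈ P.divisors.filter (fun d : ℕ => (d : ℝ) ≤ D), (1 : ℝ) / d
      ≤ ∑ d ∈ Finset.Icc 1 ⌊D⌋₊, (1 : ℝ) / d :=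
        Finset.sum_le_sum_of_subset_of_nonneg hsub fun d _ _ => by positivity
    _ = (harmonic ⌊D⌋₊ : ℝ) := by
        rw [harmonic_eq_sum_Icc]; push_cast
        refine Finset.sum_congr rfl fun d _ => by simp
    _ ≤ 1 + Real.log ⌊D⌋₊ := harmonic_le_one_add_log _
    _ ≤ 1 + Real.log D := by
        have h1 : (1 : ℝ) ≤ ⌊D⌋₊ := by exact_mod_cast Nat.le_floor (by simpa using hD)
        linarith [Real.log_le_log (by linarith) (Nat.floor_le hD0.le)]

/-- **The sieve half of Lemma 4.8.**  There is an absolute `C > 0` (the constant of the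
fundamental lemma in dimension `1` with `K = e⁵`) such that: for `q ≥ 1`, `χ (mod q)`, `Ps` a finite
set of primes in `(q, z)`, `2 ≤ z ≤ D`, `ε ≥ 0`, `M₀` with `D(M₀+1) ≤ N`, and the uniform progression
bound `|∑_{0 < m ≤ M, m ≡ c (q)} λ(m)| ≤ εM` for all `c` and `M ≥ M₀`,
`‖∑_{n ≤ N, (n,𝒟)=1} λ(n)χ(n)‖ ≤ C N e^{-log D/log z} + 2qD + qεN(1 + log D)`.
Proof: (4.1), the fundamental lemma for each `𝒜^{(b,ν)}` (same main term `(N/2q)V` for `ν = ±1`,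
which cancels), the remainders by (4.3). [cite: Lichtman2020, Lemma 4.8, proof (4.1)–(4.4)] -/
theorem exists_sifted_sum_bound :
    ∃ C : ℝ, 0 < C ∧ ∀ (Ps : Finset ℕ) (N q : ℕ), 0 < q → ∀ χ : DirichletCharacter ℂ q,
      (∀ p ∈ Ps, p.Prime) → (∀ p ∈ Ps, q < p) → ∀ z D ε : ℝ, 2 ≤ z → z ≤ D →
      (∀ p ∈ Ps, (p : ℝ) < z) → 0 ≤ ε → ∀ M₀ : ℕ, D * (M₀ + 1) ≤ N →
      (∀ c : ZMod q, ∀ M : ℕ, M₀ ≤ M →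
        |∑ m ∈ (Ioc 0 M).filter (fun m : ℕ => (m : ZMod q) = c), (liouville m : ℝ)| ≤ ε * M) →
      ‖∑ n ∈ (Icc 1 N).filter (fun n : ℕ => ∀ p ∈ Ps, ¬ p ∣ n),
          ((liouville n : ℤ) : ℂ) * χ (n : ZMod q)‖ ≤
        C * N * Real.exp (-(Real.log D / Real.log z)) + 2 * q * D + q * ε * N * (1 + Real.log D) := by
  obtain ⟨C, hC, hFL⟩ := SieveSequence.fundamental_lemma_uniform_holds 1 (Real.exp 5)
  refine ⟨C, hC, ?_⟩
  intro Ps N q hq χ hPs hPq z D ε hz hzD hPz hε M₀ hN hΛ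
  haveI : NeZero q := ⟨hq.ne'⟩
  have hq' : (0 : ℝ) < q := by exact_mod_cast hq
  have hD1 : 1 ≤ D := by linarith
  have hD0 : 0 < D := by linarith
  have hN0 : (0 : ℝ) ≤ N := Nat.cast_nonneg _
  -- the common error bound `E`
  set E := C * ((N : ℝ) / (2 * q)) * Real.exp (-(Real.log D / Real.log z))
    + (D + ε * N / 2 * (1 + Real.log D)) with hE
  -- the fundamental lemma for each sign class
  have hclass : ∀ (b : ZMod q) (ν : ℤ), ν = 1 ∨ ν = -1 →
      ∃ V : ℝ, |(#((signClass N q b ν).filter (fun n : ℕ => ∀ p ∈ Ps, ¬ p ∣ n)) : ℝ)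
        - (N : ℝ) / (2 * q) * V| ≤ E ∧
        V = (classSeq N q b 1 Ps).densityProduct (primesProdBelow z) := by
    intro b ν hν
    set A := classSeq N q b ν Ps with hA
    have hsize : A.size (N : ℝ) = (N : ℝ) / (2 * q) := rfl
    have hsize0 : 0 ≤ A.size (N : ℝ) := by rw [hsize]; positivity
    have hV : A.densityProduct (primesProdBelow z) = (classSeq N q b 1 Ps).densityProduct (primesProdBelow z) := rfl
    obtain ⟨hV0, hV1⟩ := densityProduct_mem N q b ν Ps (primesProdBelow z)
    refine ⟨A.densityProduct (primesProdBelow z), ?_, hV⟩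
    have h1 := hFL A (hasSieveDimension_psRecip Ps) (N : ℝ) z D hz hzD hsize0
    rw [classSeq_sifted hPs hPz, hsize] at h1
    refine h1.trans (add_le_add ?_ ?_)
    · -- main error: `V ≤ 1`
      have : C * ((N : ℝ) / (2 * q)) * A.densityProduct (primesProdBelow z) *
          Real.exp (-(Real.log D / Real.log z)) ≤
          C * ((N : ℝ) / (2 * q)) * 1 * Real.exp (-(Real.log D / Real.log z)) := by
        gcongr
      simpa using this
    · -- remainders
      have hrem : ∀ d ∈ (primesProdBelow z).divisors.filter (fun d : ℕ => (d : ℝ) ≤ D),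
          |A.remainder d N| ≤ 1 + (ε * ((N : ℝ) / d)) / 2 := by
        intro d hd
        rw [Finset.mem_filter, Nat.mem_divisors] at hd
        have hdpos : 0 < d := Nat.pos_of_dvd_of_pos hd.1.1 (Nat.pos_of_ne_zero hd.1.2)
        have hd' : (0 : ℝ) < d := by exact_mod_cast hdpos
        refine abs_remainder_le hPs hq hPq b hν hd.1.1 fun c => ?_
        -- `N/d ≥ M₀`
        have hM₀ : M₀ ≤ N / d := by
          rw [Nat.le_div_iff_mul_le hdpos]
          have h2 : (M₀ : ℝ) * d ≤ N := by
            calc (M₀ : ℝ) * d ≤ (M₀ + 1) * D := by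
                  have : (M₀ : ℝ) ≤ M₀ + 1 := by linarith
                  exact mul_le_mul this hd.2 hd'.le (by positivity)
              _ = D * (M₀ + 1) := by ring
              _ ≤ N := hN
          exact_mod_cast h2
        refine (hΛ c (N / d) hM₀).trans ?_
        exact mul_le_mul_of_nonneg_left Nat.cast_div_le hε
      calc ∑ d ∈ (primesProdBelow z).divisors.filter (fun d : ℕ => (d : ℝ) ≤ D), |A.remainder d N|
          ≤ ∑ d ∈ (primesProdBelow z).divisors.filter (fun d : ℕ => (d : ℝ) ≤ D),
              (1 + (ε * N / 2) * (1 / (d : ℝ))) := by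
            refine Finset.sum_le_sum fun d hd => (hrem d hd).trans (le_of_eq ?_)
            ring
        _ = #((primesProdBelow z).divisors.filter (fun d : ℕ => (d : ℝ) ≤ D)) +
              (ε * N / 2) * ∑ d ∈ (primesProdBelow z).divisors.filter (fun d : ℕ => (d : ℝ) ≤ D),
                (1 / (d : ℝ)) := by
            rw [Finset.sum_add_distrib, Finset.sum_const, nsmul_eq_mul, mul_one, Finset.mul_sum]
        _ ≤ D + (ε * N / 2) * (1 + Real.log D) := by
            gcongr
            · exact BFI.card_divisors_filter_le _ hD0.le
            · exact sum_divisors_filter_inv_le _ hD1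
  -- (4.1) and the cancellation of the main terms
  rw [sifted_sum_eq χ N Ps]
  have hterm : ∀ b : ZMod q, ‖χ b *
      ((#((signClass N q b 1).filter (fun n : ℕ => ∀ p ∈ Ps, ¬ p ∣ n)) : ℂ) -
        #((signClass N q b (-1)).filter (fun n : ℕ => ∀ p ∈ Ps, ¬ p ∣ n)))‖ ≤ 2 * E := by
    intro b
    obtain ⟨V, h1, hV1⟩ := hclass b 1 (Or.inl rfl)
    obtain ⟨V', h2, hV2⟩ := hclass b (-1) (Or.inr rfl)
    have hVV : V' = V := by rw [hV1, hV2]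
    rw [hVV] at h2
    rw [norm_mul]
    have hχ : ‖χ b‖ ≤ 1 := χ.norm_le_one b
    have hdiff : ‖((#((signClass N q b 1).filter (fun n : ℕ => ∀ p ∈ Ps, ¬ p ∣ n)) : ℂ) -
        #((signClass N q b (-1)).filter (fun n : ℕ => ∀ p ∈ Ps, ¬ p ∣ n)))‖ ≤ 2 * E := by
      rw [← Complex.ofReal_natCast, ← Complex.ofReal_natCast, ← Complex.ofReal_sub, Complex.norm_real,
        Real.norm_eq_abs]
      calc _ = |((#((signClass N q b 1).filter (fun n : ℕ => ∀ p ∈ Ps, ¬ p ∣ n)) : ℝ) - (N : ℝ) / (2 * q) * V)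
            - ((#((signClass N q b (-1)).filter (fun n : ℕ => ∀ p ∈ Ps, ¬ p ∣ n)) : ℝ) - (N : ℝ) / (2 * q) * V)| := by
            ring_nf
        _ ≤ E + E := abs_sub _ _ |>.trans (add_le_add h1 h2)
        _ = 2 * E := by ring
    have hE0 : 0 ≤ 2 * E := le_trans (norm_nonneg _) hdiff
    calc ‖χ b‖ * _ ≤ 1 * (2 * E) := mul_le_mul hχ hdiff (norm_nonneg _) zero_le_one
      _ = 2 * E := one_mul _
  calc ‖∑ b : ZMod q, χ b * ((#((signClass N q b 1).filter (fun n : ℕ => ∀ p ∈ Ps, ¬ p ∣ n)) : ℂ) -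
        #((signClass N q b (-1)).filter (fun n : ℕ => ∀ p ∈ Ps, ¬ p ∣ n)))‖
      ≤ ∑ b : ZMod q, ‖χ b * ((#((signClass N q b 1).filter (fun n : ℕ => ∀ p ∈ Ps, ¬ p ∣ n)) : ℂ) -
        #((signClass N q b (-1)).filter (fun n : ℕ => ∀ p ∈ Ps, ¬ p ∣ n)))‖ := norm_sum_le _ _
    _ ≤ ∑ _b : ZMod q, 2 * E := Finset.sum_le_sum fun b _ => hterm b
    _ = q * (2 * E) := by rw [Finset.sum_const, Finset.card_univ, ZMod.card, nsmul_eq_mul]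
    _ = C * N * Real.exp (-(Real.log D / Real.log z)) + 2 * q * D + q * ε * N * (1 + Real.log D) := by
        rw [hE]; field_simp; ring

end LiouvilleSifted

end Literature.NumberTheory.Sieve
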